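import Summits.KontsevichZagierPeriods.KontsevichZagierPeriods.Theorems.LinRedNormalFormArrangementNormalFormStubRebaseSimpleZeroNestedDiffE2Pieces

/-!
# Stub `stub_rebaseSimpleZeroTwo`, part `HPar1` (crux `ArrangementNormalForm`, line `janus-bands`)
— brick `NestedDiffE2Frame`

**Every datum of the normalised frame is good** (`RebaseE2.good_frame`). A datum of the interval
normal form (`RebaseE1.IsDN`: clean nest `A(y) < tᵢ < tⱼ < τ` over `{l < y < u}`, base pole `r`
outside the open interval) with constant top `τ`, constant outer letter `κ`, inner letter `cᵢ` of
slope `λ ≠ 0` and wall `ρ = cᵢ(r)` is good for `GG 0 2 2`, by the position of the wall: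
* `ρ > τ` — gap (`RebaseE2.good_gap_top`);
* `ρ = τ` (`RebaseE2.good_top`) — pole at an end ⇒ the band pinches there (`RebaseE2.pinch_left`)
  ⇒ bottom through the centre ⇒ base blow-up (`good_blow_centre`); else `good_lower`;
* `ρ ≤ A` on the interval (`RebaseE2.good_above`) — strict at both ends ⇒ gap; `A ≡ ρ` ⇒ base
  blow-up (`good_blow_const`); a corner at an end ⇒ cut the interval at its midpoint
  (`IsDN.good_split`): corner piece (`good_corner`) and gap piece;
* `A < ρ < τ` on the interval (`RebaseE2.good_below`) — three-piece cut at the wall height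
  (`IsDN.good_cut`): LOWER `good_lower`, MIDDLE product, UPPER `good_blow_const`;
* a bottom crossing the wall inside the interval — cut the interval at the (rational) crossing.
Registered: `rebaseSimpleZero_e2Frame`.

References: M. Kontsevich, D. Zagier, *Periods* (2001), §1.2, rules (1a), (1b), (2).
-/

noncomputable section

open Set MeasureTheory MvPolynomial
open Literature.NumberTheory.Transcendental Literature.ModelTheory.ExponentialFields

namespace Summit.KontsevichZagierPeriods.ArrangementNormalForm.JanusBands

namespace RebaseE2

open SeparatePos RebasePos RebaseZero RebaseNest RebaseDiff RebaseE1

variable {i j : Fin 2} {s : KZ.IntegralRep (0 + 1 + 2)} {l u : ℚ} {A B : Cf} {τ : ℚ} {T : BData}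
  {p : MvPolynomial (Fin 0) ℚ} {a : Fin 2 → Option Cf} {ci cj : Cf}

/-! ### Margins on half-intervals -/

/-- A positive distance from the pole on a left part `(l, q)`, `q < u`, once the pole is not `l`. -/
theorem margin_left (h : IsDN s l u A B T p a i j) (hl : T.ℓ₂.2 ≠ l) (q : ℚ) (hqu : q < u) :
    ∃ my : ℝ, 0 < my ∧ ∀ y : ℝ, (l : ℝ) < y → y < q → my ≤ |y - T.ℓ₂.2| := by
  rcases h.pole with hp | hp
  · have hlt : (T.ℓ₂.2 : ℝ) < l := by exact_mod_cast lt_of_le_of_ne hp hl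
    exact ⟨l - T.ℓ₂.2, by linarith, fun y h1 _ => by rw [abs_of_pos (by linarith)]; linarith⟩
  · have hle : (u : ℝ) ≤ T.ℓ₂.2 := by exact_mod_cast hp
    have hqu' : (q : ℝ) < u := by exact_mod_cast hqu
    exact ⟨(u : ℝ) - q, by linarith, fun y _ h2 => by rw [abs_of_neg (by linarith)]; linarith⟩

/-- A positive distance from the pole on a right part `(q, u)`, `l < q`, once the pole is not `u`. -/
theorem margin_right (h : IsDN s l u A B T p a i j) (hu : T.ℓ₂.2 ≠ u) (q : ℚ) (hlq : l < q) :
    ∃ my : ℝ, 0 < my ∧ ∀ y : ℝ, (q : ℝ) < y → y < u → my ≤ |y - T.ℓ₂.2| := by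
  rcases h.pole with hp | hp
  · have hle : (T.ℓ₂.2 : ℝ) ≤ l := by exact_mod_cast hp
    have hlq' : (l : ℝ) < q := by exact_mod_cast hlq
    exact ⟨(q : ℝ) - l, by linarith, fun y h1 _ => by rw [abs_of_pos (by linarith)]; linarith⟩
  · have hlt : (u : ℝ) < T.ℓ₂.2 := by exact_mod_cast lt_of_le_of_ne hp (Ne.symm hu)
    exact ⟨(T.ℓ₂.2 : ℝ) - u, by linarith, fun y _ h2 => by rw [abs_of_neg (by linarith)]; linarith⟩

/-! ### The wall at the top -/

/-- **The wall IS the top** (`τ = ρ`). If the base pole is an end of the interval the band pinches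
there (`pinch_left` / `pinch_right`), so the bottom passes through the centre `(r, ρ)` and the
base blow-up applies (`good_blow_centre`); otherwise the pole keeps a positive distance and the
robust edge lemma applies (`good_lower`, the outer letter being off the top by `top_ne_outer`).
[Kontsevich–Zagier 2001, §1.2] -/
theorem good_top (h : IsDN s l u A (mk 0 τ) T p a i j) (hi : a i = some ci) (hj : a j = some cj)
    (hcj : cj.1 (Fin.last 0) = 0) (hlam : ci.1 (Fin.last 0) ≠ 0) (h1 : T.n₁ = 0) (hn : T.n₂ = 1)
    (hK : Kc T p ≠ 0) (ρ : ℚ) (hρ : ρ = ci.2 - (0 - ci.1 (Fin.last 0)) * T.ℓ₂.2) (hτρ : τ = ρ) :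
    Good 2 (KZ.of s) := by
  by_cases hl : T.ℓ₂.2 = l
  · have hpin := pinch_left h hi hj h1 hn hK hl
    rw [ev_mk0] at hpin
    refine good_blow_centre h hi hj hcj h1 hn ρ hρ hτρ ?_
    rw [hl, ← hτρ]
    have key : (A.1 (Fin.last 0) : ℝ) * l + A.2 = τ := hpin
    exact_mod_cast key
  by_cases hu : T.ℓ₂.2 = u
  · have hpin := pinch_right h hi hj h1 hn hK hu
    rw [ev_mk0] at hpin
    refine good_blow_centre h hi hj hcj h1 hn ρ hρ hτρ ?_
    rw [hu, ← hτρ]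
    have key : (A.1 (Fin.last 0) : ℝ) * u + A.2 = τ := hpin
    exact_mod_cast key
  · obtain ⟨my, hmy, hregy⟩ := margin_y h hl hu
    have hκ := top_ne_outer h hi hj hcj h1 hn hK
    subst hτρ
    exact good_lower h hi hj hcj hlam h1 hn hK hρ hκ my hmy hregy

/-! ### The bottom above the wall -/

/-- **The bottom weakly above the wall** (`ρ ≤ A` on the open interval, `ρ < τ`). If `ρ < A` at both
ends, the wall keeps a positive distance (`good_gap_ends`). If `A ≡ ρ`, the pole is not an end
(no pinch) and the base blow-up applies (`good_blow_const`). Otherwise `A` meets the wall at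
exactly one end: cut the interval at its midpoint (`IsDN.good_split`); the half at the corner is
`good_corner` (the pole is not the corner end, so it keeps a positive distance from that half;
the outer letter lies below `ρ` or above `τ` by `outer_side`, `top_ne_outer`), the other half is
`good_gap_ends`. [Kontsevich–Zagier 2001, §1.2] -/
theorem good_above (h : IsDN s l u A (mk 0 τ) T p a i j) (hi : a i = some ci) (hj : a j = some cj)
    (hcj : cj.1 (Fin.last 0) = 0) (hlam : ci.1 (Fin.last 0) ≠ 0) (h1 : T.n₁ = 0) (hn : T.n₂ = 1)
    (hK : Kc T p ≠ 0) (ρ : ℚ) (hρ : ρ = ci.2 - (0 - ci.1 (Fin.last 0)) * T.ℓ₂.2) (hρτ : (ρ : ℝ) < τ)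
    (hge : ∀ y : ℝ, (l : ℝ) < y → y < u → (ρ : ℝ) ≤ ev A y) : Good 2 (KZ.of s) := by
  have hlu : (l : ℝ) < u := by exact_mod_cast h.lu
  have hdiff : ∀ y y' : ℝ, ev A y - ev A y' = (A.1 (Fin.last 0) : ℝ) * (y - y') := fun y y' => by
    rw [ev, ev]; ring
  -- the ends
  have key : ∀ y : ℝ, (l : ℝ) < y → y < u → 0 ≤ ev (A - mk 0 ρ) y := fun y h1' h2' => by
    rw [ev_sub, ev_mk0, sub_nonneg]; exact hge y h1' h2'
  have hl0 := nonneg_left_end _ h.lu key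
  have hu0 := nonneg_right_end _ h.lu key
  rw [ev_sub, ev_mk0, sub_nonneg] at hl0 hu0
  -- the outer letter, once `A` touches the wall at an end
  have hκ_of : ∀ {y₀ : ℚ}, (y₀ = l ∨ y₀ = u) → ev A y₀ = ρ → ((cj.2 : ℝ) ≤ ρ ∨ (τ : ℝ) < cj.2) := by
    intro y₀ hy₀ hAy₀
    rcases outer_side h hi hj h1 hn hK with hlo | hhi
    · left
      have key' : ∀ y : ℝ, (l : ℝ) < y → y < u → 0 ≤ ev (A - cj) y := fun y h1' h2' => by
        rw [ev_sub, sub_nonneg]; exact hlo y h1' h2'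
      rcases hy₀ with rfl | rfl
      · have := nonneg_left_end _ h.lu key'
        rw [ev_sub, ev_of_fst_eq_zero hcj, hAy₀] at this
        linarith
      · have := nonneg_right_end _ h.lu key'
        rw [ev_sub, ev_of_fst_eq_zero hcj, hAy₀] at this
        linarith
    · right
      have hmid := hhi (((l : ℝ) + u) / 2) (by linarith) (by linarith)
      rw [ev_mk0, ev_of_fst_eq_zero hcj] at hmid
      exact lt_of_le_of_ne hmid (Ne.symm (top_ne_outer h hi hj hcj h1 hn hK))
  -- the midpoint
  set q : ℚ := (l + u) / 2 with hq
  have hlq : l < q := by rw [hq]; linarith [h.lu]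
  have hqu : q < u := by rw [hq]; linarith [h.lu]
  have hlq' : (l : ℝ) < q := by exact_mod_cast hlq
  have hqu' : (q : ℝ) < u := by exact_mod_cast hqu
  rcases hl0.lt_or_eq with hl1 | hl1
  · rcases hu0.lt_or_eq with hu1 | hu1
    · -- gap at both ends
      exact good_gap_ends h hi hj hcj hlam h1 hn hK ρ hρ hl1 hu1
    · -- corner at the right end: `A(u) = ρ < A(l)`, `A' < 0`
      have hαneg : (A.1 (Fin.last 0) : ℝ) < 0 := by
        by_contra hnn
        push Not at hnn
        have := hdiff u l
        have : 0 ≤ (A.1 (Fin.last 0) : ℝ) * (u - l) := mul_nonneg hnn (by linarith)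
        linarith
      have hgt : ∀ y : ℝ, y < u → (ρ : ℝ) < ev A y := fun y h2' => by
        have := hdiff y u
        have : 0 < (A.1 (Fin.last 0) : ℝ) * (y - u) := mul_pos_of_neg_of_neg hαneg (by linarith)
        linarith
      have hru : T.ℓ₂.2 ≠ u := fun hr => by
        have := pinch_right h hi hj h1 hn hK hr
        rw [ev_mk0] at this
        linarith
      obtain ⟨my, hmy, hregy⟩ := margin_right h hru q hlq
      have hκ := hκ_of (Or.inr rfl) hu1.symm
      refine h.good_split q hlq hqu (fun s₁ h₁ => ?_) (fun s₂ h₂ => ?_)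
      · exact good_gap_ends h₁ hi hj hcj hlam h1 hn hK ρ hρ hl1 (hgt q hqu')
      · exact good_corner h₂ hi hj hcj hlam h1 hn hK ρ hρ u hu1.symm (fun y _ h2' => hgt y h2') my hmy hregy hκ
  · by_cases hA0 : A.1 (Fin.last 0) = 0
    · -- `A ≡ ρ`: constant bottom at the wall height
      have hAv : ∀ y : ℝ, ev A y = ρ := fun y => by
        have e := hl1; rw [ev_of_fst_eq_zero hA0] at e; rw [ev_of_fst_eq_zero hA0]; exact e.symm
      have hrl : T.ℓ₂.2 ≠ l := fun hr => by
        have := pinch_left h hi hj h1 hn hK hr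
        rw [hAv, ev_mk0] at this
        linarith
      have hru : T.ℓ₂.2 ≠ u := fun hr => by
        have := pinch_right h hi hj h1 hn hK hr
        rw [hAv, ev_mk0] at this
        linarith
      obtain ⟨my, hmy, hregy⟩ := margin_y h hrl hru
      have hA2 : (A.2 : ℝ) = ρ := by have e := hAv 0; rwa [ev_of_fst_eq_zero hA0] at e
      exact good_blow_const h hi hj hcj h1 hn hA0 ρ hρ hA2 my hmy hregy
    · -- corner at the left end: `A(l) = ρ`, `A' > 0`
      have hαpos : 0 < (A.1 (Fin.last 0) : ℝ) := by
        have hα' : (A.1 (Fin.last 0) : ℝ) ≠ 0 := by exact_mod_cast hA0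
        rcases lt_or_gt_of_ne hα' with hneg | hpos
        · exfalso
          have hmid := hge (((l : ℝ) + u) / 2) (by linarith) (by linarith)
          have := hdiff (((l : ℝ) + u) / 2) l
          have : (A.1 (Fin.last 0) : ℝ) * (((l : ℝ) + u) / 2 - l) < 0 := mul_neg_of_neg_of_pos hneg (by linarith)
          linarith
        · exact hpos
      have hgt : ∀ y : ℝ, (l : ℝ) < y → (ρ : ℝ) < ev A y := fun y h1' => by
        have := hdiff y l
        have : 0 < (A.1 (Fin.last 0) : ℝ) * (y - l) := mul_pos hαpos (by linarith)
        linarith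
      have hrl : T.ℓ₂.2 ≠ l := fun hr => by
        have := pinch_left h hi hj h1 hn hK hr
        rw [ev_mk0] at this
        linarith
      obtain ⟨my, hmy, hregy⟩ := margin_left h hrl q hqu
      have hκ := hκ_of (Or.inl rfl) hl1.symm
      refine h.good_split q hlq hqu (fun s₁ h₁ => ?_) (fun s₂ h₂ => ?_)
      · exact good_corner h₁ hi hj hcj hlam h1 hn hK ρ hρ l hl1.symm (fun y h1' _ => hgt y h1') my hmy hregy hκ
      · exact good_gap_ends h₂ hi hj hcj hlam h1 hn hK ρ hρ (hgt q hlq') (hgt u hlu)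

/-! ### The bottom below the wall -/

/-- **The bottom strictly below the wall, the wall strictly below the top** (`A < ρ < τ` on the
open interval): the pole is not an end (no pinch), and the three-piece cut at the wall height
(`IsDN.good_cut`, the product piece being good by the product case) leaves the LOWER nest
`A < tᵢ < tⱼ < ρ` (`good_lower`; the outer letter is off `ρ` by `outer_side`) and the UPPER nest
`ρ < tᵢ < tⱼ < τ` (`good_blow_const`). [Kontsevich–Zagier 2001, §1.2, rules (1a), (1b), (2)] -/
theorem good_below (h : IsDN s l u A (mk 0 τ) T p a i j) (hi : a i = some ci) (hj : a j = some cj)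
    (hcj : cj.1 (Fin.last 0) = 0) (hlam : ci.1 (Fin.last 0) ≠ 0) (h1 : T.n₁ = 0) (hn : T.n₂ = 1)
    (hK : Kc T p ≠ 0) (ρ : ℚ) (hρ : ρ = ci.2 - (0 - ci.1 (Fin.last 0)) * T.ℓ₂.2) (hρτ : (ρ : ℝ) < τ)
    (hlt : ∀ y : ℝ, (l : ℝ) < y → y < u → ev A y < ρ) : Good 2 (KZ.of s) := by
  have hlu : (l : ℝ) < u := by exact_mod_cast h.lu
  -- the ends
  have key : ∀ y : ℝ, (l : ℝ) < y → y < u → 0 ≤ ev (mk 0 ρ - A) y := fun y h1' h2' => by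
    rw [ev_sub, ev_mk0, sub_nonneg]; exact (hlt y h1' h2').le
  have hl0 := nonneg_left_end _ h.lu key
  have hu0 := nonneg_right_end _ h.lu key
  rw [ev_sub, ev_mk0, sub_nonneg] at hl0 hu0
  have hrl : T.ℓ₂.2 ≠ l := fun hr => by
    have := pinch_left h hi hj h1 hn hK hr
    rw [ev_mk0] at this
    linarith
  have hru : T.ℓ₂.2 ≠ u := fun hr => by
    have := pinch_right h hi hj h1 hn hK hr
    rw [ev_mk0] at this
    linarith
  obtain ⟨my, hmy, hregy⟩ := margin_y h hrl hru
  -- the outer letter is off the wall height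
  have hκρ : (cj.2 : ℝ) ≠ ρ := by
    have hm1 : (l : ℝ) < ((l : ℝ) + u) / 2 := by linarith
    have hm2 : ((l : ℝ) + u) / 2 < u := by linarith
    have hAm := hlt _ hm1 hm2
    rcases outer_side h hi hj h1 hn hK with hlo | hhi
    · have hmid := hlo _ hm1 hm2
      rw [ev_of_fst_eq_zero hcj] at hmid
      intro e
      linarith
    · have hmid := hhi _ hm1 hm2
      rw [ev_mk0, ev_of_fst_eq_zero hcj] at hmid
      intro e
      linarith
  refine h.good_cut (Or.inl h1) (mk 0 ρ) (fun y h1' h2' => by rw [ev_mk0]; exact hlt y h1' h2')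
    (fun y _ _ => by rw [ev_mk0, ev_mk0]; exact hρτ) (fun s₁ h₁ => ?_) (fun s₃ h₃ => ?_)
  · exact good_lower h₁ hi hj hcj hlam h1 hn hK hρ hκρ my hmy hregy
  · exact good_blow_const h₃ hi hj hcj h1 hn rfl ρ hρ rfl my hmy hregy

/-! ### The driver -/

/-- **Every datum of the normalised frame is good for `GG 0 2 2`.** A datum of the interval normal
form with constant top `τ`, constant outer letter, inner letter of slope `λ ≠ 0` (simple base
pole, exponents `0, 1`) is good: vanishing base constant ⇒ relation; else compare the wall
`ρ = cᵢ(r)` with the top (`good_gap_top`, `good_top`) and the bottom with the wall — constant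
bottom: `good_above` / `good_below`; sloped bottom crossing the wall height at the rational
abscissa `y_c`: cut the interval there if `l < y_c < u` (`IsDN.good_split`) and apply
`good_above` / `good_below` on each side. [Kontsevich–Zagier 2001, §1.2, rules (1a), (1b), (2)] -/
theorem good_frame (h : IsDN s l u A (mk 0 τ) T p a i j) (hi : a i = some ci) (hj : a j = some cj)
    (hcj : cj.1 (Fin.last 0) = 0) (hlam : ci.1 (Fin.last 0) ≠ 0) (h1 : T.n₁ = 0) (hn : T.n₂ = 1) :
    Good 2 (KZ.of s) := by
  by_cases hK : Kc T p = 0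
  · exact h.good_zero hK
  set ρ : ℚ := ci.2 - (0 - ci.1 (Fin.last 0)) * T.ℓ₂.2 with hρ
  clear_value ρ
  rcases lt_trichotomy τ ρ with hτ | hτ | hτ
  · exact good_gap_top h hi hj hcj hlam h1 hn hK ρ hρ (by exact_mod_cast hτ)
  · exact good_top h hi hj hcj hlam h1 hn hK ρ hρ hτ
  have hρτ : (ρ : ℝ) < τ := by exact_mod_cast hτ
  by_cases hα : A.1 (Fin.last 0) = 0
  · -- constant bottom
    by_cases hc : ρ ≤ A.2
    · refine good_above h hi hj hcj hlam h1 hn hK ρ hρ hρτ fun y _ _ => ?_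
      rw [ev_of_fst_eq_zero hα]; exact_mod_cast hc
    · refine good_below h hi hj hcj hlam h1 hn hK ρ hρ hρτ fun y _ _ => ?_
      rw [ev_of_fst_eq_zero hα]; exact_mod_cast not_le.1 hc
  -- sloped bottom: the crossing abscissa
  set yc : ℚ := (ρ - A.2) / A.1 (Fin.last 0) with hyc
  have hα' : (A.1 (Fin.last 0) : ℝ) ≠ 0 := by exact_mod_cast hα
  have hcross : ∀ y : ℝ, ev A y - ρ = (A.1 (Fin.last 0) : ℝ) * (y - yc) := fun y => by
    rw [hyc, ev, Rat.cast_div, Rat.cast_sub]; field_simp; ring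
  have habove : ∀ {s' : KZ.IntegralRep (0 + 1 + 2)} {l' u' : ℚ}, IsDN s' l' u' A (mk 0 τ) T p a i j →
      (∀ y : ℝ, (l' : ℝ) < y → y < u' → 0 < (A.1 (Fin.last 0) : ℝ) * (y - yc)) → Good 2 (KZ.of s') :=
    fun h' hs => good_above h' hi hj hcj hlam h1 hn hK ρ hρ hρτ fun y h1' h2' => by
      linarith [hcross y, hs y h1' h2']
  have hbelow : ∀ {s' : KZ.IntegralRep (0 + 1 + 2)} {l' u' : ℚ}, IsDN s' l' u' A (mk 0 τ) T p a i j →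
      (∀ y : ℝ, (l' : ℝ) < y → y < u' → (A.1 (Fin.last 0) : ℝ) * (y - yc) < 0) → Good 2 (KZ.of s') :=
    fun h' hs => good_below h' hi hj hcj hlam h1 hn hK ρ hρ hρτ fun y h1' h2' => by
      linarith [hcross y, hs y h1' h2']
  by_cases h1c : yc ≤ l
  · -- the whole interval lies to the right of the crossing
    have h1c' : (yc : ℝ) ≤ l := by exact_mod_cast h1c
    rcases lt_or_gt_of_ne hα' with hneg | hpos
    · exact hbelow h fun y h1' _ => mul_neg_of_neg_of_pos hneg (by linarith)
    · exact habove h fun y h1' _ => mul_pos hpos (by linarith)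
  by_cases h2c : u ≤ yc
  · -- the whole interval lies to the left of the crossing
    have h2c' : (u : ℝ) ≤ yc := by exact_mod_cast h2c
    rcases lt_or_gt_of_ne hα' with hneg | hpos
    · exact habove h fun y _ h2' => mul_pos_of_neg_of_neg hneg (by linarith)
    · exact hbelow h fun y _ h2' => mul_neg_of_pos_of_neg hpos (by linarith)
  -- the crossing lies inside: cut there
  push Not at h1c h2c
  refine h.good_split yc h1c h2c (fun s₁ h₁ => ?_) (fun s₂ h₂ => ?_)
  · rcases lt_or_gt_of_ne hα' with hneg | hpos
    · exact habove h₁ fun y _ h2' => mul_pos_of_neg_of_neg hneg (by linarith)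
    · exact hbelow h₁ fun y _ h2' => mul_neg_of_pos_of_neg hpos (by linarith)
  · rcases lt_or_gt_of_ne hα' with hneg | hpos
    · exact hbelow h₂ fun y h1' _ => mul_neg_of_neg_of_pos hneg (by linarith)
    · exact habove h₂ fun y h1' _ => mul_pos hpos (by linarith)

end RebaseE2

/-- **Registered brick `rebaseSimpleZero_e2Frame` of the part `HPar1` (stub `stub_rebaseSimpleZeroTwo`,
line `janus-bands`): every datum of the normalised frame is good.** A datum of the interval normal
form (`RebaseE1.IsDN`: clean nest `A(y) < tᵢ < tⱼ < τ` over the literal interval `{l < y < u}`,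
literal `GS 0 2` integrand with simple base pole `r = ℓ₂.2` outside the open interval) whose
top `τ` and outer letter are constant and whose inner letter has non-zero `y`-slope is congruent
modulo `KZ.relations` to the subgroup generated by `GG 0 2 2` (`RebaseE2.good_frame`: the E2 case
analysis by the position of the wall `ρ = cᵢ(r)` of the edge expansion of `tᵢ`).
[Kontsevich–Zagier 2001, §1.2, rules (1a), (1b), (2)] -/
theorem rebaseSimpleZero_e2Frame (i j : Fin 2) (s : KZ.IntegralRep (0 + 1 + 2)) (l u : ℚ) (A ci cj : (Fin (0 + 1) → ℚ) × ℚ) (τ : ℚ) (T : RebaseZero.BData) (p : MvPolynomial (Fin 0) ℚ) (a : Fin 2 → Option ((Fin (0 + 1) → ℚ) × ℚ)) (h : RebaseE1.IsDN s l u A (RebaseZero.mk 0 τ) T p a i j) (hi : a i = some ci) (hj : a j = some cj) (hcj : cj.1 (Fin.last 0) = 0) (hlam : ci.1 (Fin.last 0) ≠ 0) (h1 : T.n₁ = 0) (hn : T.n₂ = 1) : ∃ c ∈ AddSubgroup.closure (SeparatePos.GGset 0 2 2), KZ.of s - c ∈ KZ.relations :=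
  RebaseE2.good_frame h hi hj hcj hlam h1 hn

end Summit.KontsevichZagierPeriods.ArrangementNormalForm.JanusBands
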